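import Summits.ABC.ABC.Theorems.RibetTakahashiSplitAbcValuationProductTwoPrimes
import Summits.ABC.ABC.Theorems.RibetTakahashiSplitAbcValuationProductReductions
import Summits.ABC.ABC.Theorems.RibetTakahashiSplitAbcValuationProductFreyClass

/-!
# `AbcValuationProduct`: the few-prime input is sub-exponential abc in the Pillai regime, and
# every polynomial abc bound implies the milestone

The route item `Summit.ABC.ABC.Theses.RibetTakahashiSplit.AbcValuationProduct` (stmt-ABC-1567:
`∀ ε > 0 ∃ K, ∀ abc triples, ∏_{p ∣ abc} ν_p(abc) ≤ K · rad(abc)^ε` — Pasten's Theorem 1.10 of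
arXiv:1705.09251 with `8/3 + ε` replaced by `ε`) is an OPEN milestone. The sibling files record
`ABC ⟹ AbcValuationProduct ⟹ SubexpABC` (`…Reductions`), the `ω(abc)`-decomposition with the
two-prime regime settled by Mihăilescu (`…TwoPrimes`), and `AbcValuationProduct ⟺ r2F ∧ r4F`
(`…FreyClass`). This file sharpens both ends of that picture.

* `abcValuationProduct_of_polynomialABC` — **any polynomial abc bound implies the milestone**:
  `(∃ A C, ∀ abc triples, c ≤ C · rad^A) → AbcValuationProduct`, by the divisor bound
  `∏ ν_p(abc) ≤ d(abc) ≤ C_δ (abc)^δ ≤ C_δ c^{3δ}` at `δ = ε/(3A)`. The hypothesis is, verbatim, the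
  conclusion shape of the polynomial-abc milestones of the other ABC routes
  (`FermatTwistHeights.PolynomialABC`, the conclusions of `FeketeScales.PolynomialAbcOfSubmult` and
  `DefiniteXi.PolyDegreeToPolyABC`), and `WeakABCConjecture` (`c < rad²`) is the case `A = 2`
  (`abcValuationProduct_of_weakABCConjecture`). So the milestone sits BELOW every polynomial abc
  statement in the tree and ABOVE `SubexpABC` / `SubexpABCManyPrimes`
  (`subexp_of_abcValuationProduct` here-imported; `subexpABCManyPrimes_of_abcValuationProduct` in
  `…SubexpABCManyPrimesPosition`).
* `AbcValuationProduct.exponentProduct_le_of_log_le` — the pointwise core in the other direction: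
  for a triple with `ω(abc) ≤ k` and `log c ≤ κ rad^δ`,
  `∏ ν_p(abc) ≤ (3κ/log 2 + 1)^k rad^{δk}`, because each `ν_p(abc) ≤ log(abc)/log 2 ≤ 3 log c/log 2`.
  Hence, for every FIXED bound `k` on `ω(abc)`, the product-of-valuations bound with exponent `ε` and
  the sub-exponential bound `log c ≤ κ_ε rad^ε` are EQUIVALENT
  (`AbcValuationProduct.bddOmega_iff_subexp`; the converse is glue C pointwise).
* `abcValuationProduct_iff_fiveLe_and_subexpThreeFour` — consequently the milestone is, unconditionally,
  `[∏ ν_p ≪_ε rad^ε on ω(abc) ≥ 5] ∧ [log c ≪_ε rad^ε on ω(abc) ∈ {3, 4}]`; and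
  `abcValuationProduct_iff_manyPrimeFrey_and_subexpThreeFour` —
  **`AbcValuationProduct ⟺ ManyPrimeValuationProductFrey ∧ SubexpPillai`**, where `SubexpPillai` is
  sub-exponential abc for the coprime `S`-unit equations `a + b = c` with `S = {2, p, q}` or
  `{2, p, q, r}` (`p^x ± q^y = 2^z`, `2^z p^x ± q^y = r^w`, …): `log c ≤ κ_ε (∏_{ℓ ∈ S} ℓ)^ε`.
  Modulo the crux r2F the milestone is therefore EXACTLY "beat every Baker-shape bound
  (Stewart–Yu: `log c ≪ rad^{1/3} (log rad)^3`) down to `rad^{o(1)}` for `|S| ≤ 4`"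
  (`abcValuationProduct_iff_subexpThreeFour_of_manyPrimeValuationProductFrey`) — a statement about
  four-term-support `S`-unit equations with no elliptic curve in it; this, not the few-prime crux
  `FewPrimeValuationProduct` on all curves semistable away from `2`, is what stmt-ABC-1567 consumes
  on the few-prime side.

No new definitions; all statements are in the vocabulary of
`Literature.NumberTheory.DiophantineGeometry` (`IsABCTriple`, `rad`, `exponentProduct`).

References: H. Pasten, *Shimura curves and the abc conjecture*, J. Number Theory 254 (2024)
= arXiv:1705.09251, Thm 1.10, Conj. 1.14; C. L. Stewart, K. Yu, *On the abc conjecture II*,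
Duke Math. J. 108 (2001); G. H. Hardy, E. M. Wright, Thm 315 (divisor bound).
-/

-- `Summit.<Summit>.<Problem>` is the mandated summit-side namespace (CONVENTIONS §2); for the
-- single-conjunct summit `ABC` the two coincide, so the duplicate `ABC.ABC` is deliberate.
set_option linter.dupNamespace false

noncomputable section

namespace Summit.ABC.ABC.Theorems

open WeierstrassCurve
open Literature.NumberTheory.EllipticCurves Literature.NumberTheory.DiophantineGeometry
open Summit.ABC.ABC.Theses.RibetTakahashiSplit

/-! ### `∏ ν_p(n) ≤ (log n / log 2)^{ω(n)}` -/

/-- `ν_p(n) ≤ log n / log 2` for `n ≠ 0` and `p` prime: `2^{ν_p(n)} ≤ p^{ν_p(n)} ≤ n`. `[folklore]` -/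
theorem AbcValuationProduct.factorization_le_log_div {n p : ℕ} (hn : n ≠ 0) (hp : p.Prime) :
    (n.factorization p : ℝ) ≤ Real.log n / Real.log 2 := by
  have hlog2 : 0 < Real.log 2 := Real.log_pos (by norm_num)
  rw [le_div_iff₀ hlog2, ← Real.log_pow]
  apply Real.log_le_log (by positivity)
  have h1 : 2 ^ n.factorization p ≤ p ^ n.factorization p := Nat.pow_le_pow_left hp.two_le _
  have h2 : p ^ n.factorization p ≤ n :=
    Nat.le_of_dvd (Nat.pos_of_ne_zero hn) (Nat.ordProj_dvd n p)
  exact_mod_cast h1.trans h2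

/-- `∏_{p ∣ n} ν_p(n) ≤ (log n / log 2)^{ω(n)}` for `n ≠ 0`. `[folklore]` -/
theorem AbcValuationProduct.exponentProduct_le_pow_card {n : ℕ} (hn : n ≠ 0) :
    (exponentProduct n : ℝ) ≤ (Real.log n / Real.log 2) ^ n.primeFactors.card := by
  rw [exponentProduct_def, Nat.cast_prod, ← Finset.prod_const]
  exact Finset.prod_le_prod (fun _ _ => by positivity) fun p hp =>
    AbcValuationProduct.factorization_le_log_div hn (Nat.prime_of_mem_primeFactors hp)

/-! ### Bounded `ω(abc)`: the valuation product and `log c` control each other -/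

/-- **Pointwise core.** For an abc triple with `ω(abc) ≤ k` and `log c ≤ κ · rad(abc)^δ`
(`κ, δ ≥ 0`): `∏_{p ∣ abc} ν_p(abc) ≤ (3κ/log 2 + 1)^k · rad(abc)^{δk}`. Each factor satisfies
`ν_p(abc) ≤ log(abc)/log 2 ≤ 3 log c/log 2 ≤ (3κ/log 2) rad^δ ≤ M := (3κ/log 2 + 1) rad^δ`, `M ≥ 1`,
and there are at most `k` factors. `[folklore]` -/
theorem AbcValuationProduct.exponentProduct_le_of_log_le {a b c : ℕ} (h : IsABCTriple a b c)
    {k : ℕ} (hk : (a * b * c).primeFactors.card ≤ k) {κ δ : ℝ} (hκ : 0 ≤ κ) (hδ : 0 ≤ δ)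
    (hc : Real.log c ≤ κ * (rad a b c : ℝ) ^ δ) :
    (exponentProduct (a * b * c) : ℝ) ≤
      (3 * κ / Real.log 2 + 1) ^ k * (rad a b c : ℝ) ^ (δ * k) := by
  have h0 : a * b * c ≠ 0 := h.mul_ne_zero
  have hR : (0 : ℝ) < (rad a b c : ℝ) := cast_rad_pos a b c
  set R : ℝ := (rad a b c : ℝ) with hRdef
  have hR1 : (1 : ℝ) ≤ R := by
    rw [hRdef]; exact_mod_cast (le_trans (by norm_num) h.two_le_rad : 1 ≤ rad a b c)
  have hRδ : 1 ≤ R ^ δ := Real.one_le_rpow hR1 hδ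
  have hlog2 : 0 < Real.log 2 := Real.log_pos (by norm_num)
  have hκ' : 0 ≤ 3 * κ / Real.log 2 := by positivity
  set M : ℝ := (3 * κ / Real.log 2 + 1) * R ^ δ with hMdef
  have hM1 : 1 ≤ M := by
    calc (1 : ℝ) ≤ 1 * R ^ δ := by rw [one_mul]; exact hRδ
      _ ≤ (3 * κ / Real.log 2 + 1) * R ^ δ := by gcongr; linarith
  -- `log(abc) ≤ 3 log c`
  have hlogabc : Real.log ((a * b * c : ℕ) : ℝ) ≤ 3 * Real.log c := by
    have h1 : ((a * b * c : ℕ) : ℝ) ≤ (c : ℝ) ^ 3 := by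
      exact_mod_cast AbcValuationProduct.mul_le_pow_three h
    calc Real.log ((a * b * c : ℕ) : ℝ) ≤ Real.log ((c : ℝ) ^ 3) :=
          Real.log_le_log (by exact_mod_cast Nat.pos_of_ne_zero h0) h1
      _ = 3 * Real.log c := by rw [Real.log_pow]; norm_num
  -- each exponent is at most `M`
  have hv : ∀ p ∈ (a * b * c).primeFactors, ((a * b * c).factorization p : ℝ) ≤ M := by
    intro p hp
    calc ((a * b * c).factorization p : ℝ) ≤ Real.log ((a * b * c : ℕ) : ℝ) / Real.log 2 :=
          AbcValuationProduct.factorization_le_log_div h0 (Nat.prime_of_mem_primeFactors hp)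
      _ ≤ 3 * Real.log c / Real.log 2 := div_le_div_of_nonneg_right hlogabc hlog2.le
      _ ≤ 3 * (κ * R ^ δ) / Real.log 2 := by gcongr
      _ = (3 * κ / Real.log 2) * R ^ δ := by ring
      _ ≤ M := by rw [hMdef, add_mul, one_mul]; linarith
  calc (exponentProduct (a * b * c) : ℝ)
      = ∏ p ∈ (a * b * c).primeFactors, ((a * b * c).factorization p : ℝ) := by
        rw [exponentProduct_def, Nat.cast_prod]
    _ ≤ ∏ _p ∈ (a * b * c).primeFactors, M :=
        Finset.prod_le_prod (fun _ _ => by positivity) hv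
    _ = M ^ (a * b * c).primeFactors.card := Finset.prod_const M
    _ ≤ M ^ k := pow_le_pow_right₀ hM1 hk
    _ = (3 * κ / Real.log 2 + 1) ^ k * (R ^ δ) ^ k := mul_pow _ _ _
    _ = (3 * κ / Real.log 2 + 1) ^ k * R ^ (δ * k) := by
        rw [← Real.rpow_natCast (R ^ δ) k, ← Real.rpow_mul hR.le]

/-- **Bounded `ω`: sub-exponential abc ⟹ the product-of-valuations bound.** If
`log c ≤ κ_ε rad(abc)^ε` for every `ε > 0` on the abc triples with `ω(abc) ≤ k`, then
`∏ ν_p(abc) ≤ K_ε rad(abc)^ε` for every `ε > 0` on the same triples (apply the pointwise core at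
`ε/(k+1)` with `k + 1` factors allowed). `[folklore]` -/
theorem AbcValuationProduct.bddOmega_of_subexp (k : ℕ)
    (h : ∀ ε : ℝ, 0 < ε → ∃ κ : ℝ, ∀ a b c : ℕ, IsABCTriple a b c →
      (a * b * c).primeFactors.card ≤ k → Real.log c ≤ κ * (rad a b c : ℝ) ^ ε) :
    ∀ ε : ℝ, 0 < ε → ∃ K : ℝ, ∀ a b c : ℕ, IsABCTriple a b c →
      (a * b * c).primeFactors.card ≤ k →
      (exponentProduct (a * b * c) : ℝ) ≤ K * (rad a b c : ℝ) ^ ε := by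
  intro ε hε
  obtain ⟨κ, hκ⟩ := h (ε / ((k : ℝ) + 1)) (by positivity)
  refine ⟨(3 * max κ 0 / Real.log 2 + 1) ^ (k + 1), fun a b c ht hω => ?_⟩
  have hR : (0 : ℝ) < (rad a b c : ℝ) := cast_rad_pos a b c
  have hc : Real.log c ≤ max κ 0 * (rad a b c : ℝ) ^ (ε / ((k : ℝ) + 1)) :=
    (hκ a b c ht hω).trans (mul_le_mul_of_nonneg_right (le_max_left _ _)
      (Real.rpow_nonneg hR.le _))
  have key := AbcValuationProduct.exponentProduct_le_of_log_le ht (Nat.le_succ_of_le hω)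
    (le_max_right _ _) (by positivity) hc
  rwa [show ε / ((k : ℝ) + 1) * ((k + 1 : ℕ) : ℝ) = ε by push_cast; field_simp] at key

/-- **Bounded `ω`: the product-of-valuations bound ⟹ sub-exponential abc** (glue C of the route,
pointwise: `log c ≤ (∏ ν_p) log rad` and `log x ≤ (2/ε) x^{ε/2}`; the restriction on `ω` is carried
along unchanged). `[folklore]` -/
theorem AbcValuationProduct.subexp_of_bddOmega (k : ℕ)
    (h : ∀ ε : ℝ, 0 < ε → ∃ K : ℝ, ∀ a b c : ℕ, IsABCTriple a b c →
      (a * b * c).primeFactors.card ≤ k →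
      (exponentProduct (a * b * c) : ℝ) ≤ K * (rad a b c : ℝ) ^ ε) :
    ∀ ε : ℝ, 0 < ε → ∃ κ : ℝ, ∀ a b c : ℕ, IsABCTriple a b c →
      (a * b * c).primeFactors.card ≤ k → Real.log c ≤ κ * (rad a b c : ℝ) ^ ε := by
  intro ε hε
  obtain ⟨K, hK⟩ := h (ε / 2) (by positivity)
  exact ⟨2 * max K 0 / ε, fun a b c ht hω =>
    AbcValuationProduct.log_le_of_exponentProduct_le hε K ht (hK a b c ht hω)⟩

/-- **For every fixed bound on `ω(abc)` the two bounds are equivalent**: on the abc triples with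
`ω(abc) ≤ k`, `∀ ε, ∏ ν_p(abc) ≪_ε rad^ε` iff `∀ ε, log c ≪_ε rad^ε`. (For unbounded `ω` only "⟹"
survives: `ω(abc)` itself can be `≍ log rad / log log rad`.) `[folklore]` -/
theorem AbcValuationProduct.bddOmega_iff_subexp (k : ℕ) :
    (∀ ε : ℝ, 0 < ε → ∃ K : ℝ, ∀ a b c : ℕ, IsABCTriple a b c →
      (a * b * c).primeFactors.card ≤ k →
      (exponentProduct (a * b * c) : ℝ) ≤ K * (rad a b c : ℝ) ^ ε) ↔
    (∀ ε : ℝ, 0 < ε → ∃ κ : ℝ, ∀ a b c : ℕ, IsABCTriple a b c →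
      (a * b * c).primeFactors.card ≤ k → Real.log c ≤ κ * (rad a b c : ℝ) ^ ε) :=
  ⟨AbcValuationProduct.subexp_of_bddOmega k, AbcValuationProduct.bddOmega_of_subexp k⟩

/-- The window `ω(abc) ∈ {3, 4}`: sub-exponential abc there gives the product-of-valuations bound
there (pointwise core at `ε/4`, `k = 4`). `[folklore]` -/
theorem AbcValuationProduct.threeFour_of_subexpThreeFour
    (h : ∀ ε : ℝ, 0 < ε → ∃ κ : ℝ, ∀ a b c : ℕ, IsABCTriple a b c →
      3 ≤ (a * b * c).primeFactors.card → (a * b * c).primeFactors.card ≤ 4 →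
      Real.log c ≤ κ * (rad a b c : ℝ) ^ ε) :
    ∀ ε : ℝ, 0 < ε → ∃ K : ℝ, ∀ a b c : ℕ, IsABCTriple a b c →
      3 ≤ (a * b * c).primeFactors.card → (a * b * c).primeFactors.card ≤ 4 →
      (exponentProduct (a * b * c) : ℝ) ≤ K * (rad a b c : ℝ) ^ ε := by
  intro ε hε
  obtain ⟨κ, hκ⟩ := h (ε / 4) (by positivity)
  refine ⟨(3 * max κ 0 / Real.log 2 + 1) ^ 4, fun a b c ht h3 h4 => ?_⟩
  have hR : (0 : ℝ) < (rad a b c : ℝ) := cast_rad_pos a b c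
  have hc : Real.log c ≤ max κ 0 * (rad a b c : ℝ) ^ (ε / 4) :=
    (hκ a b c ht h3 h4).trans (mul_le_mul_of_nonneg_right (le_max_left _ _)
      (Real.rpow_nonneg hR.le _))
  have key := AbcValuationProduct.exponentProduct_le_of_log_le ht h4 (le_max_right _ _)
    (by positivity) hc
  rwa [show ε / 4 * ((4 : ℕ) : ℝ) = ε by push_cast; ring] at key

/-- The window `ω(abc) ∈ {3, 4}`: the product-of-valuations bound there gives sub-exponential abc
there (glue C pointwise). `[folklore]` -/
theorem AbcValuationProduct.subexpThreeFour_of_threeFour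
    (h : ∀ ε : ℝ, 0 < ε → ∃ K : ℝ, ∀ a b c : ℕ, IsABCTriple a b c →
      3 ≤ (a * b * c).primeFactors.card → (a * b * c).primeFactors.card ≤ 4 →
      (exponentProduct (a * b * c) : ℝ) ≤ K * (rad a b c : ℝ) ^ ε) :
    ∀ ε : ℝ, 0 < ε → ∃ κ : ℝ, ∀ a b c : ℕ, IsABCTriple a b c →
      3 ≤ (a * b * c).primeFactors.card → (a * b * c).primeFactors.card ≤ 4 →
      Real.log c ≤ κ * (rad a b c : ℝ) ^ ε := by
  intro ε hε
  obtain ⟨K, hK⟩ := h (ε / 2) (by positivity)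
  exact ⟨2 * max K 0 / ε, fun a b c ht h3 h4 =>
    AbcValuationProduct.log_le_of_exponentProduct_le hε K ht (hK a b c ht h3 h4)⟩

/-! ### Above the milestone: every polynomial abc bound -/

/-- **Polynomial abc ⟹ `AbcValuationProduct`.** If `c ≤ C · rad(abc)^A` for all abc triples (some
fixed `A, C`), then `∏ ν_p(abc) ≪_ε rad(abc)^ε`: with `A' = max(A,1)`, `C' = max(C,1)` and the divisor
bound `d(n) ≤ D_δ n^δ` (Hardy–Wright Thm 315, `exists_card_divisors_le_mul_rpow`) at `δ = ε/(3A')`,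
`∏ ν_p(abc) ≤ d(abc) ≤ D (abc)^δ ≤ D (c³)^δ ≤ D (C'³ rad^{3A'})^δ = D C'^{3δ} rad^ε`. The hypothesis is
the shape of `FermatTwistHeights.PolynomialABC` and of the conclusions of
`FeketeScales.PolynomialAbcOfSubmult` / `DefiniteXi.PolyDegreeToPolyABC`; `abcValuationProduct_of_abc`
is the case `A = 2`. `[folklore]` -/
theorem abcValuationProduct_of_polynomialABC
    (hpoly : ∃ A C : ℝ, ∀ a b c : ℕ, IsABCTriple a b c → (c : ℝ) ≤ C * (rad a b c : ℝ) ^ A) :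
    AbcValuationProduct := by
  obtain ⟨A, C, hAC⟩ := hpoly
  intro ε hε
  set A' : ℝ := max A 1 with hA'
  set C' : ℝ := max C 1 with hC'
  have hA'0 : 0 < A' := lt_of_lt_of_le one_pos (le_max_right _ _)
  have hC'0 : 0 < C' := lt_of_lt_of_le one_pos (le_max_right _ _)
  have hδ : (0 : ℝ) < ε / (3 * A') := by positivity
  obtain ⟨D, hD1, hD⟩ := Literature.NumberTheory.Sieve.exists_card_divisors_le_mul_rpow hδ
  refine ⟨D * (C' ^ 3) ^ (ε / (3 * A')), fun a b c ht => ?_⟩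
  have h0 : a * b * c ≠ 0 := ht.mul_ne_zero
  have hR : (0 : ℝ) < (rad a b c : ℝ) := cast_rad_pos a b c
  set R : ℝ := (rad a b c : ℝ) with hRdef
  have hR1 : (1 : ℝ) ≤ R := by
    rw [hRdef]; exact_mod_cast (le_trans (by norm_num) ht.two_le_rad : 1 ≤ rad a b c)
  -- `c ≤ C' R^{A'}`
  have hc : (c : ℝ) ≤ C' * R ^ A' :=
    calc (c : ℝ) ≤ C * R ^ A := hAC a b c ht
      _ ≤ C' * R ^ A := mul_le_mul_of_nonneg_right (le_max_left _ _) (by positivity)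
      _ ≤ C' * R ^ A' := mul_le_mul_of_nonneg_left
          (Real.rpow_le_rpow_of_exponent_le hR1 (le_max_left _ _)) hC'0.le
  -- `abc ≤ c³ ≤ C'³ R^{3A'}`
  have habc_le : ((a * b * c : ℕ) : ℝ) ≤ C' ^ 3 * R ^ (3 * A') := by
    have h1 : ((a * b * c : ℕ) : ℝ) ≤ (c : ℝ) ^ 3 := by
      exact_mod_cast AbcValuationProduct.mul_le_pow_three ht
    calc ((a * b * c : ℕ) : ℝ) ≤ (c : ℝ) ^ 3 := h1
      _ ≤ (C' * R ^ A') ^ 3 := by gcongr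
      _ = C' ^ 3 * (R ^ A') ^ (3 : ℕ) := mul_pow _ _ _
      _ = C' ^ 3 * R ^ (3 * A') := by
          congr 1
          rw [← Real.rpow_natCast (R ^ A') 3, ← Real.rpow_mul hR.le]
          congr 1
          push_cast
          ring
  -- `(abc)^δ ≤ (C'³)^δ R^ε`
  have hpow : ((a * b * c : ℕ) : ℝ) ^ (ε / (3 * A')) ≤ (C' ^ 3) ^ (ε / (3 * A')) * R ^ ε := by
    calc ((a * b * c : ℕ) : ℝ) ^ (ε / (3 * A')) ≤ (C' ^ 3 * R ^ (3 * A')) ^ (ε / (3 * A')) :=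
          Real.rpow_le_rpow (by positivity) habc_le hδ.le
      _ = (C' ^ 3) ^ (ε / (3 * A')) * (R ^ (3 * A')) ^ (ε / (3 * A')) :=
          Real.mul_rpow (by positivity) (by positivity)
      _ = (C' ^ 3) ^ (ε / (3 * A')) * R ^ ε := by
          rw [← Real.rpow_mul hR.le]
          congr 2
          field_simp
  calc (exponentProduct (a * b * c) : ℝ) ≤ ((a * b * c).divisors.card : ℝ) := by
        exact_mod_cast exponentProduct_le_card_divisors h0
    _ ≤ D * ((a * b * c : ℕ) : ℝ) ^ (ε / (3 * A')) := hD _ h0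
    _ ≤ D * ((C' ^ 3) ^ (ε / (3 * A')) * R ^ ε) := mul_le_mul_of_nonneg_left hpow (by linarith)
    _ = D * (C' ^ 3) ^ (ε / (3 * A')) * R ^ ε := by ring

/-- **The weak abc conjecture implies the milestone**: `WeakABCConjecture` (`c < rad(abc)²` for every
abc triple, abc.S03, open) gives `AbcValuationProduct` (the case `A = 2`, `C = 1` of
`abcValuationProduct_of_polynomialABC`). `[folklore]` -/
theorem abcValuationProduct_of_weakABCConjecture (hweak : WeakABCConjecture) :
    AbcValuationProduct :=
  abcValuationProduct_of_polynomialABC ⟨2, 1, fun a b c ht => by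
    rw [one_mul, Real.rpow_two]
    exact_mod_cast (hweak a b c ht).le⟩

/-! ### The many-prime half from the crux r2F -/

-- adapted from Summits/ABC/ABC/Theorems/RibetTakahashiSplitManyPrimeValuationProductFreyClassSuffices.lean
-- (`abcValuationProduct_of_manyPrimeFreyClass`): the `≥ 4` branch only, in `ω` form.
/-- **Many-prime half of the milestone from r2F alone.** `ManyPrimeValuationProductFrey`
(stmt-ABC-15149) implies `∏ ν_p(abc) ≤ K_ε rad(abc)^ε` for every abc triple with `ω(abc) ≥ 5`: the
curve `W` of `FreyClassSuffices.exists_freyCurve_model` lies in the Frey–Hellegouarch class, is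
semistable away from `2`, has the `≥ 4` odd primes of `abc` among its odd multiplicative primes and
`N_W ∣ 2¹⁰ rad(abc)`, so r2F gives `T(W) ≤ C N_W^ε` and `∏ ν_p(abc) ≤ 4 T(W) ≤ 4C (2¹⁰ rad)^ε`.
[cite: BombieriGubler2006, Ex. 12.5.10] -/
theorem AbcValuationProduct.fiveLe_of_manyPrimeValuationProductFrey
    (h₂ : ManyPrimeValuationProductFrey) :
    ∀ ε : ℝ, 0 < ε → ∃ K : ℝ, ∀ a b c : ℕ, IsABCTriple a b c →
      5 ≤ (a * b * c).primeFactors.card →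
      (exponentProduct (a * b * c) : ℝ) ≤ K * (rad a b c : ℝ) ^ ε := by
  intro ε hε
  obtain ⟨C, hC⟩ := h₂ ε hε
  refine ⟨4 * max C 0 * ((2 : ℝ) ^ 10) ^ ε, fun a b c habc hω => ?_⟩
  obtain ⟨W, hE, hss, hfrey, hN, hsub, hprod⟩ := FreyClassSuffices.exists_freyCurve_model habc
  haveI := hE
  -- `≥ 4` odd multiplicative primes
  have h4 : 4 ≤ ((W.conductorNorm ℤ).primeFactors.filter
      (fun p => p ≠ 2 ∧ ¬ p ^ 2 ∣ W.conductorNorm ℤ)).card :=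
    calc 4 ≤ (a * b * c).primeFactors.card - 1 := by omega
      _ ≤ ((a * b * c).primeFactors.erase 2).card := Finset.pred_card_le_card_erase
      _ ≤ _ := Finset.card_le_card hsub
  have hT : (multiplicativeValuationProduct W : ℝ) ≤ max C 0 * (W.conductorNorm ℤ : ℝ) ^ ε :=
    (hC W hss hfrey h4).trans (mul_le_mul_of_nonneg_right (le_max_left _ _) (by positivity))
  have hR : (0 : ℝ) < (rad a b c : ℝ) := cast_rad_pos a b c
  have hNR : (W.conductorNorm ℤ : ℝ) ≤ 2 ^ 10 * (rad a b c : ℝ) := by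
    have := Nat.le_of_dvd (mul_pos (by positivity) (by rw [rad_def]; exact Nat.radical_pos _)) hN
    exact_mod_cast this
  calc (exponentProduct (a * b * c) : ℝ) ≤ ((4 * multiplicativeValuationProduct W : ℕ) : ℝ) := by
        rw [exponentProduct_def]; exact_mod_cast hprod
    _ = 4 * (multiplicativeValuationProduct W : ℝ) := by push_cast; ring
    _ ≤ 4 * (max C 0 * (W.conductorNorm ℤ : ℝ) ^ ε) := by linarith
    _ ≤ 4 * (max C 0 * ((2 : ℝ) ^ 10 * (rad a b c : ℝ)) ^ ε) := by gcongr
    _ = 4 * max C 0 * ((2 : ℝ) ^ 10) ^ ε * (rad a b c : ℝ) ^ ε := by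
        rw [Real.mul_rpow (by positivity) hR.le]; ring

/-! ### The milestone = r2F ∧ sub-exponential abc in the Pillai regime -/

/-- **The milestone, decomposed (unconditional).** `AbcValuationProduct` is equivalent to the
conjunction of `[∏ ν_p(abc) ≪_ε rad^ε on ω(abc) ≥ 5]` and `[log c ≪_ε rad^ε on ω(abc) ∈ {3, 4}]`
(`abcValuationProduct_iff_fiveLe_and_threeFour` — the regime `ω(abc) ≤ 2` is Mihăilescu — with the
window conjunct converted by `AbcValuationProduct.threeFour_of_subexpThreeFour` /
`subexpThreeFour_of_threeFour`). `[folklore]` -/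
theorem abcValuationProduct_iff_fiveLe_and_subexpThreeFour :
    AbcValuationProduct ↔
      (∀ ε : ℝ, 0 < ε → ∃ K : ℝ, ∀ a b c : ℕ, IsABCTriple a b c →
        5 ≤ (a * b * c).primeFactors.card →
        (exponentProduct (a * b * c) : ℝ) ≤ K * (rad a b c : ℝ) ^ ε) ∧
      (∀ ε : ℝ, 0 < ε → ∃ κ : ℝ, ∀ a b c : ℕ, IsABCTriple a b c →
        3 ≤ (a * b * c).primeFactors.card → (a * b * c).primeFactors.card ≤ 4 →
        Real.log c ≤ κ * (rad a b c : ℝ) ^ ε) :=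
  abcValuationProduct_iff_fiveLe_and_threeFour.trans (and_congr_right'
    ⟨AbcValuationProduct.subexpThreeFour_of_threeFour,
      AbcValuationProduct.threeFour_of_subexpThreeFour⟩)

/-- **`AbcValuationProduct ⟺ r2F ∧ SubexpPillai`.** The milestone (stmt-ABC-1567) is equivalent to
the conjunction of the many-prime crux on the Frey–Hellegouarch class `ManyPrimeValuationProductFrey`
(stmt-ABC-15149) and sub-exponential abc in the Pillai regime: `log c ≤ κ_ε rad(abc)^ε` for the abc
triples with `ω(abc) ∈ {3, 4}`, i.e. for the coprime `S`-unit equations `a + b = c` over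
`S = {2, p, q}` or `{2, p, q, r}` (`p^x ± q^y = 2^z`, `p^x q^y ± 1 = 2^z`, `2^z p^x ± q^y = r^w`, …),
uniformly in the primes. "⟹": `manyPrimeValuationProductFrey_of_abcValuationProduct` and glue C;
"⟸": `AbcValuationProduct.fiveLe_of_manyPrimeValuationProductFrey` and the decomposition.
`[folklore]` -/
theorem abcValuationProduct_iff_manyPrimeFrey_and_subexpThreeFour :
    AbcValuationProduct ↔
      (ManyPrimeValuationProductFrey ∧
        ∀ ε : ℝ, 0 < ε → ∃ κ : ℝ, ∀ a b c : ℕ, IsABCTriple a b c →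
          3 ≤ (a * b * c).primeFactors.card → (a * b * c).primeFactors.card ≤ 4 →
          Real.log c ≤ κ * (rad a b c : ℝ) ^ ε) := by
  refine ⟨fun h => ⟨manyPrimeValuationProductFrey_of_abcValuationProduct h,
    (abcValuationProduct_iff_fiveLe_and_subexpThreeFour.mp h).2⟩, fun h => ?_⟩
  exact abcValuationProduct_iff_fiveLe_and_subexpThreeFour.mpr
    ⟨AbcValuationProduct.fiveLe_of_manyPrimeValuationProductFrey h.1, h.2⟩

/-- **Modulo r2F, the milestone is sub-exponential abc in the Pillai regime.** Given
`ManyPrimeValuationProductFrey`, `AbcValuationProduct` holds iff `log c ≤ κ_ε rad(abc)^ε` on the abc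
triples with `ω(abc) ∈ {3, 4}` — improving every Baker-shape bound (Stewart–Yu:
`log c ≪ rad^{1/3} (log rad)^3`) to `rad^{o(1)}` for the `S`-unit equations with `|S| ≤ 4`, `2 ∈ S`.
This, and not the few-prime crux `FewPrimeValuationProduct` on all curves semistable away from `2`,
is the few-prime input stmt-ABC-1567 consumes. `[folklore]` -/
theorem abcValuationProduct_iff_subexpThreeFour_of_manyPrimeValuationProductFrey
    (h₂ : ManyPrimeValuationProductFrey) :
    AbcValuationProduct ↔ ∀ ε : ℝ, 0 < ε → ∃ κ : ℝ, ∀ a b c : ℕ, IsABCTriple a b c →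
      3 ≤ (a * b * c).primeFactors.card → (a * b * c).primeFactors.card ≤ 4 →
      Real.log c ≤ κ * (rad a b c : ℝ) ^ ε := by
  rw [abcValuationProduct_iff_manyPrimeFrey_and_subexpThreeFour]
  exact ⟨fun h => h.2, fun h => ⟨h₂, h⟩⟩

end Summit.ABC.ABC.Theorems

end
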